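import Literature.AlgebraicGeometry.ModuliOfAbelianVarieties.SiegelHeckeQuotientFamilyPointwise
import Literature.AlgebraicGeometry.ModuliOfAbelianVarieties.SiegelHeckeKernelIndexSet
import Literature.AlgebraicGeometry.AbelianSchemes.IsogenyDivisorClauseBaseChange
import HarnessLib

/-!
# The `hfam` input of the socket-(B) assembly from the algebraic quotient datum, kernel in MATRIX form, polarisation
# clause in `Λ`-witness form ([Milne2005ShimuraVarieties] §5 Def. 5.14, §6 Thm. 6.11; [MumfordAV1970] §7 Thm. 4, §23)

Topic `AlgebraicGeometry/ModuliOfAbelianVarieties`; namespace `Literature.AlgebraicGeometry.ModuliOfAbelianVarieties`.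
KERNEL ONLY: one theorem; no definition, no named fact, no instance, no `sorry`.

Cell hodgecm-mathlib (D-0151), Hecke-link line, socket (B).  Composition of ★ `SiegelHeckeQuotientFamilyPointwise`
(`exists_hom_baseChange_forall_pointwiseHeckeQuotient`: the `hfam` binder of `Theorems/EquidimHeckeQuotientMap` from a
source family `P′` of class `ι′`, a target family `Q`, a surjective `S″`-homomorphism `ψ` with `hlev`, `hker`, `hW`) with
the two currency conversions of the line: ★ `SiegelHeckeKernelIndexSet.exists_adelicCongr_iff_mulVec_eq_zero` (the ADELIC
index set `K₀ᵃ` of the section-kernel clause `=` the MATRIX index set `K₀ᵐ = ker(γ̄ · R′)`, `R′ = r′ mod N′`, in which ★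
`LevelStructureTwistAlongIsogeny` reads the kernel of the construction) and ★
`IsogenyDivisorClauseBaseChange.linEquiv_pullback_translation_sub_baseChange_id` ((W‴) on the fibre-at-`𝟙` models from
the `Λ`-witness statement `H : ψ_t^*Θ₀` witnesses `λ′^ν` on the fibres `A_t` — ★ `IsLambdaOfAt.pullback_isogeny` under
`ψ ≫ λ_Q ≫ ψ^∨ = λ′^ν`).  So the producers of the quotient TRIPLE feed `hfam` with: the kernel of `ψ` on fibre points as
`{σ′_c(s) | (γ̄ R′) c = 0}` (★ `comp_quotientMk_eq_one_iff_of_range`) and `H` in the `A_t` model — no adelic bookkeeping,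
no fibre-at-`𝟙` transport on their side.

* `exists_hom_baseChange_forall_pointwiseHeckeQuotient_of_kernel` — the statement; conclusion VERBATIM the `hfam` binder.

## References
* [Milne2005ShimuraVarieties] J. S. Milne, *Introduction to Shimura varieties* (2005), §5 p. 58 (Def. 5.14), §6 Thm. 6.11
  p. 74 and p. 75.
* [MumfordAV1970] D. Mumford, *Abelian Varieties* (1970), §7 Thm. 4 (p. 72), §23 (Thm. 2, p. 231).
* [MumfordFogartyKirwan1994] GIT (3rd ed.), Ch. 7 §3 Thm. 7.9 (p. 139).
HC_CM is proved only modulo the 7 printed citations until rung 0 closes; this file discharges none of them.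
-/

set_option autoImplicit false

noncomputable section

open CategoryTheory CategoryTheory.Limits AlgebraicGeometry Matrix NumberField IsDedekindDomain
open Literature.AlgebraicGeometry.Motives (SchemeOver ComplexPoints AlgPoints specOver baseChangeHom baseChangeHomFst
  CartierDivisor AbelianVariety)
open Literature.AlgebraicGeometry.AbelianSchemes (PolarizedAbelianSchemeWithLevel AbelianSchemeOver)
open Literature.AlgebraicGeometry.AbelianSchemes.AbelianSchemeOver (fibreHom baseChangeHom isMonHom_baseChangeHom
  isDominant_toSchemeHom_fibreHom)
open Literature.NumberTheory.Adeles

namespace Literature.AlgebraicGeometry.ModuliOfAbelianVarieties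

open SiegelModuli
open scoped MonObj

/-- **`hfam` FROM THE QUOTIENT DATUM, kernel in matrix form, polarisation clause in `Λ`-witness form** (module
docstring): for a source family `P′` over the complex piece `S″` with fibres of class `ι′ s`, a target family `Q`, a
surjective `S″`-homomorphism `ψ : P′.A → Q.A` (locally of finite type) with `Q.σᵢ = P′.σᵢ^d ≫ ψ`, whose kernel on the
fibre points over every complex point is `{σ′_c(s) | (γ̄ · R′) c = 0}` (`γ̄ = γq mod N′` integral, `R′ = r′ mod N′`,
`r, r′ ∈ K_δ(1)`), and such that `ψ_t^*Θ₀` witnesses `λ_{P′}^ν` whenever `Θ₀` witnesses `λ_Q` (every point `t`), the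
classifying map of `Q` read over `ℂ` is an algebraic `qℂ : S″ → 𝓜 ⊗ ℂ` all of whose fibres are pointwise Hecke quotients
in the section-kernel shape. [cite: Milne2005ShimuraVarieties, §5 p. 58 (Def. 5.14) and §6 Thm. 6.11 p. 74 and p. 75]
[cite: MumfordAV1970, §7 Thm. 4 (p. 72)] [cite: MumfordFogartyKirwan1994, Ch. 7 §3 Theorem 7.9 (p. 139)] -/
theorem exists_hom_baseChange_forall_pointwiseHeckeQuotient_of_kernel {g N N' d : ℕ} {δ : Fin g → ℕ} [NeZero N']
    (𝓜 : SiegelFineModuliScheme g N δ) (𝓜' : SiegelFineModuliScheme g N' δ) [IsLocallyNoetherian (specOver ℚ ℂ).left]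
    {S'' : SchemeOver ℂ} [IsLocallyNoetherian S''.left]
    (ι' : S'' ⟶ (Literature.AlgebraicGeometry.Motives.baseChange ℚ ℂ).obj 𝓜'.M)
    (P' : PolarizedAbelianSchemeWithLevel g N' δ S''.left)
    (hP' : ∀ s : ComplexPoints S'',
      AlgPoints.baseChangeEquiv (algebraMap ℚ ℂ) 𝓜'.M (𝓜'.classifyingMap (specOver ℚ ℂ) (P'.baseChange s.left)) =
        AlgPoints.map (L := ℂ) ι' s)
    (Q : PolarizedAbelianSchemeWithLevel g N δ S''.left)
    (ψ : P'.A.X ⟶ Q.A.X) [IsMonHom ψ] [Surjective ψ.left] [LocallyOfFiniteType ψ.left]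
    (r r' : gspFinAdelic δ) (hr : r ∈ principalLevelSubgroup δ 1) (hr' : r' ∈ principalLevelSubgroup δ 1)
    (γq : GL (Fin g ⊕ Fin g) ℚ) (γm : Matrix (Fin g ⊕ Fin g) (Fin g ⊕ Fin g) ℤ)
    (hγ : ((γq : GL (Fin g ⊕ Fin g) ℚ) : Matrix (Fin g ⊕ Fin g) (Fin g ⊕ Fin g) ℚ) = γm.map (Int.cast : ℤ → ℚ))
    (R' : Matrix (Fin g ⊕ Fin g) (Fin g ⊕ Fin g) (ZMod N'))
    (hR' : ∀ (i j : Fin g ⊕ Fin g)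
      (h : ((r' : GL (Fin g ⊕ Fin g) finAdeleQ) : Matrix (Fin g ⊕ Fin g) (Fin g ⊕ Fin g) finAdeleQ) i j ∈
        FiniteAdeleRing.integralAdeles (𝓞 ℚ) ℚ), R' i j = integralAdeleResidue N' ⟨_, h⟩)
    (ν : ℕ)
    (hlev : ∀ i, Q.level.σ i = (P'.level.σ i ^ d) ≫ ψ)
    (hK : ∀ (s : ComplexPoints S'') (x : P'.A.FibrePoints s.left),
      x ≫ ψ = 1 ↔ ∃ c ∈ {c : Fin g ⊕ Fin g → ZMod N' | (γm.map (Int.castRingHom (ZMod N')) * R') *ᵥ c = 0},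
        x = P'.A.restrict s.left (P'.level.section_ c))
    (H : ∀ (t : Spec (.of ℂ) ⟶ S''.left) (Θ₀ : CartierDivisor (Q.A.fibre t).toAbelianVariety.X.left),
      haveI := isDominant_toSchemeHom_fibreHom ψ t
      Q.A.IsLambdaOfAt t Q.D Q.pol.lam Θ₀ →
        P'.A.IsLambdaOfAt t P'.D (P'.pol.lam ^ ν) (Θ₀.pullback (AbelianVariety.Hom.toSchemeHom (fibreHom ψ t)))) :
    ∃ qℂ : S'' ⟶ (Literature.AlgebraicGeometry.Motives.baseChange ℚ ℂ).obj 𝓜.M, ∀ s : ComplexPoints S'',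
      ∃ (U : PolarizedAbelianSchemeWithLevel g N' δ (specOver ℚ ℂ).left)
        (_ : AlgPoints.baseChangeEquiv (algebraMap ℚ ℂ) 𝓜'.M (𝓜'.classifyingMap (specOver ℚ ℂ) U) =
          AlgPoints.map (L := ℂ) ι' s)
        (Q : PolarizedAbelianSchemeWithLevel g N δ (specOver ℚ ℂ).left)
        (ψ : (U.A.fibre (𝟙 (Spec (CommRingCat.of ℂ)))).toAbelianVariety ⟶
          (Q.A.fibre (𝟙 (Spec (CommRingCat.of ℂ)))).toAbelianVariety)
        (_ : IsDominant ψ.hom.hom.hom.left),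
        (Q.A.fibre (𝟙 (Spec (CommRingCat.of ℂ)))).toAbelianVariety.dim = g ∧
        (∀ P : (U.A.fibre (𝟙 (Spec (CommRingCat.of ℂ)))).toAbelianVariety.Points ℂ,
          AlgPoints.map ψ.hom.hom.hom P = 1 ↔
            ∃ c : Fin g ⊕ Fin g → ZMod N',
              (∃ v : Fin g ⊕ Fin g → ℚ,
                (γq : Matrix (Fin g ⊕ Fin g) (Fin g ⊕ Fin g) ℚ) *ᵥ v ∈ latticeOfGL (r : GL (Fin g ⊕ Fin g) finAdeleQ) ∧
                AdelicCongr ((r'⁻¹ : gspFinAdelic δ) : GL (Fin g ⊕ Fin g) finAdeleQ) 1 v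
                  (fun i => ((c i).val : ℚ) / N')) ∧
              P = U.A.restrictPt (𝟙 (Spec (CommRingCat.of ℂ))) (U.level.section_ c)) ∧
        Function.Surjective (AlgPoints.map (L := ℂ) ψ.hom.hom.hom :
          (U.A.fibre (𝟙 (Spec (CommRingCat.of ℂ)))).toAbelianVariety.Points ℂ →
            (Q.A.fibre (𝟙 (Spec (CommRingCat.of ℂ)))).toAbelianVariety.Points ℂ) ∧
        (∀ i : Fin g ⊕ Fin g,
          Q.A.restrictPt (𝟙 (Spec (CommRingCat.of ℂ))) (Q.level.σ i) =
            AlgPoints.map ψ.hom.hom.hom (U.A.restrictPt (𝟙 (Spec (CommRingCat.of ℂ))) (U.level.σ i ^ d))) ∧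
        (∀ (Θ' : CartierDivisor (U.A.fibre (𝟙 (Spec (CommRingCat.of ℂ)))).toAbelianVariety.X.left)
          (Θ : CartierDivisor (Q.A.fibre (𝟙 (Spec (CommRingCat.of ℂ)))).toAbelianVariety.X.left),
          U.A.IsLambdaOfAt (𝟙 (Spec (CommRingCat.of ℂ))) U.D U.pol.lam Θ' →
          Q.A.IsLambdaOfAt (𝟙 (Spec (CommRingCat.of ℂ))) Q.D Q.pol.lam Θ →
          ∀ y : (U.A.fibre (𝟙 (Spec (CommRingCat.of ℂ)))).toAbelianVariety.Points ℂ,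
            (((Θ.pullback ψ.hom.hom.hom.left + -(ν • Θ')).pullback
              ((U.A.fibre (𝟙 (Spec (CommRingCat.of ℂ)))).toAbelianVariety.translation y).left).LinEquiv
              (Θ.pullback ψ.hom.hom.hom.left + -(ν • Θ')))) ∧
        AlgPoints.baseChangeEquiv (algebraMap ℚ ℂ) 𝓜.M (𝓜.classifyingMap (specOver ℚ ℂ) Q) = AlgPoints.map (L := ℂ) qℂ s := by
  refine exists_hom_baseChange_forall_pointwiseHeckeQuotient 𝓜 𝓜' ι' P' hP' Q ψ r r' γq ν hlev ?_
    (fun s => PolarizedAbelianSchemeWithLevel.linEquiv_pullback_translation_sub_baseChange_id P' Q ψ ν H s.left)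
  intro s x
  rw [hK s x]
  refine exists_congr fun c => and_congr_left fun _ => ?_
  exact (exists_adelicCongr_iff_mulVec_eq_zero r r' hr hr' γq γm hγ R' hR' c).symm

end Literature.AlgebraicGeometry.ModuliOfAbelianVarieties

end
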